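import Summits.AnomalousDissipation.AnomalousDissipation.Theorems.SolenoidalFractalHomogenisationLagrangianStepD1TailCertDefs
import Summits.AnomalousDissipation.AnomalousDissipation.Theorems.SolenoidalFractalHomogenisationLagrangianStepD1Family
import HarnessLib

/-!
# K1L_D `stub_D1_residueTail` (registry v17, stmt-AnomalousDissipation-27980) — lane A1/A4: THE SLOT-PAIR PRESENTATION `F` OF THE TAIL and lane A's
# table `gTail` (shared definitions; `--kind definition --supports stmt-AnomalousDissipation-27980 --as helper`)

Summits-side DEFINITIONS file of route `SolenoidalFractalHomogenisation` (prover seat `ad-sawtooth-k1loc-p1` g13, lane A owner; interface of the tail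
certificate `Lines/onelevel-D1-tail-cert.md` §1–§2 = landed `D1TailCert.relSmall_tail_of_table (hg) hS hτ hodd F hstruct hbound`).
* `Mre ν S j j' i l` — the real part of the `(i,l)` entry of the period-mean feedback matrix `M_{jj'}` of `Sideband.psiStar cubatureWord MB MB_pos ν S`
  (pickup slot `j`, source slot `j'`; `0` off `ν > 0`);
* `freshMat S j j'` — the FRESH parts subtracted by `excQS` (diagonal: `slotCoefⱼ • slotQⱼ`) and by `pairQS` (forward colinear pairs
  `(j,j') = (2l+1, 2l)`: `slotCoef_{2l} • pairQ S (2l)`), `0` for every other ordered pair;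
* **`tailKernel ν S p q j j' = Σ_{i,l} pᵢ q_l ((ν/4π²)·Mre ν S j j' i l − freshMat S j j' i l)`** — lane A's `F` (`hstruct`:
  `bsymb (psiStar − excQS − pairQS) k p q = Σ_{jj'} (eⱼ·k)(e_{j'}·k)·F p q j j'`);
* **`gTail j j' = G0 · (τⱼ/‖mⱼ‖) · Bst j' · e^{−θmin}`** — lane A's product table (pickup `1/(2|mⱼ|)` per unit amplitude on both fibres, no in-slot decay,
  state `Bst`, one full slot of free decay in every cell); Frobenius weight `Σ gTail²/(wN·wN) ≈ 5.0·10⁻⁴ ≤ (1/23)²` (`D1TailCert.frob_product_le` with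
  `A j = τⱼ/‖mⱼ‖ = 2√2·ApickC j`, `UA = 8·7·10¹⁶`, `UB = 44·10¹²`).
Definitions + unfolding lemmas only; no theorem of substance, no named fact, no sorry.  NOT a proof of anything; rung leaf F-D1 infrastructure.
-/

set_option linter.dupNamespace false

noncomputable section

namespace Summit.AnomalousDissipation.AnomalousDissipation.Theorems.SolenoidalFractalHomogenisation.LagrangianStep.D1Tail

open Summit.AnomalousDissipation.AnomalousDissipation.Theorems
open Summit.AnomalousDissipation.AnomalousDissipation.Theorems.SolenoidalFractalHomogenisation.LagrangianStep
open Summit.AnomalousDissipation.AnomalousDissipation.Theorems.SolenoidalFractalHomogenisation.LagrangianStep.WCrossing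
open Summit.AnomalousDissipation.AnomalousDissipation.Theorems.SolenoidalFractalHomogenisation.LagrangianStep.D1ResidueCert
open Summit.AnomalousDissipation.AnomalousDissipation.Theorems.SolenoidalFractalHomogenisation.LagrangianStep.D1TailCert
open Literature.Analysis Literature.Analysis.FluidPDE Literature.Analysis.FunctionSpaces
open Set Real

/-! ## §1 The entries of the period-mean feedback and the fresh parts -/

/-- **Real part of the `(i,l)` entry of the period-mean feedback matrix `M_{jj'}`** of the exact family at viscosity `ν > 0` and shape `S`
(`W₁ = (cubatureWord.stretch MB).stretch (1/ν)`, `𝔸 = ν•S`, `γ₁ = 1`, `R = R0 ν`); `0` off `ν > 0`. [cite: MajdaKramer1999, §2.2.1.3 (55)] -/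
def Mre (ν : ℝ) (S : T4) (j j' : Fin 26) (i l : Fin 3) : ℝ :=
  if hν : 0 < ν then
    ((Sideband.meanFeedback ((cubatureWord.stretch MB MB_pos).stretch (1 / ν) (one_div_pos.mpr hν)) (ν • S) 1 (Sideband.R0 ν) j j'
      (EuclideanSpace.single l (1:ℂ))) i).re
  else 0

/-- Unfolding `Mre` for `ν > 0`. [cite: MajdaKramer1999, §2.2.1.3 (55)] -/
theorem Mre_of_pos {ν : ℝ} (hν : 0 < ν) (S : T4) (j j' : Fin 26) (i l : Fin 3) :
    Mre ν S j j' i l = ((Sideband.meanFeedback ((cubatureWord.stretch MB MB_pos).stretch (1 / ν) (one_div_pos.mpr hν)) (ν • S) 1 (Sideband.R0 ν) j j'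
      (EuclideanSpace.single l (1:ℂ))) i).re := by
  simp [Mre, hν]

/-- **The fresh parts**: `slotCoefⱼ • slotQⱼ` on the diagonal (the `excQS` slot term), `slotCoef_{2l} • pairQ S (2l)` on the forward colinear pairs
`(j,j') = (2l+1, 2l)` (the `pairQS` term), `0` otherwise. [cite: ArmstrongVicol2025, §3 (renormalised diffusivity of one level)] -/
def freshMat (S : T4) (j j' : Fin 26) : Matrix (Fin 3) (Fin 3) ℝ :=
  (if j = j' then slotCoef cubatureWord j • slotQ cubatureWord MB S j else 0) +
    ∑ l : Fin 13, if j = sndSlot l ∧ j' = fstSlot l then slotCoef cubatureWord (fstSlot l) • pairQ S (fstSlot l) else 0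

/-- Unfolding `freshMat`. [cite: ArmstrongVicol2025, §3] -/
theorem freshMat_def (S : T4) (j j' : Fin 26) :
    freshMat S j j' = (if j = j' then slotCoef cubatureWord j • slotQ cubatureWord MB S j else 0) +
      ∑ l : Fin 13, if j = sndSlot l ∧ j' = fstSlot l then slotCoef cubatureWord (fstSlot l) • pairQ S (fstSlot l) else 0 := rfl

/-! ## §2 Lane A's slot-pair presentation `F` and table `g` -/

/-- **Lane A's slot-pair presentation of the tail** (`F` of `D1TailCert.relSmall_tail_of_table`):
`tailKernel ν S p q j j' = Σ_{i,l} pᵢ q_l ((ν/4π²)·Mre ν S j j' i l − freshMat S j j' i l)`. [cite: ArmstrongVicol2025, §3 (renormalised diffusivity of one level)] -/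
def tailKernel (ν : ℝ) (S : T4) (p q : Fin 3 → ℝ) (j j' : Fin 26) : ℝ :=
  ∑ i, ∑ l, p i * q l * (ν / (4 * π ^ 2) * Mre ν S j j' i l - freshMat S j j' i l)

/-- Unfolding `tailKernel`. [cite: ArmstrongVicol2025, §3] -/
theorem tailKernel_def (ν : ℝ) (S : T4) (p q : Fin 3 → ℝ) (j j' : Fin 26) :
    tailKernel ν S p q j j' = ∑ i, ∑ l, p i * q l * (ν / (4 * π ^ 2) * Mre ν S j j' i l - freshMat S j j' i l) := rfl

/-- **Lane A's table**: `gTail j j' = G0 · (τⱼ/‖mⱼ‖) · Bst j' · e^{−θmin}` (pickup slot `j`, source slot `j'`). [cite: ArmstrongVicol2025, §3] -/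
def gTail (j j' : Fin 26) : ℝ :=
  G0 * ((cubatureWord.phase j).τ / ‖Torus.latticeVec (cubatureWord.phase j).m‖) * Bst j' * Real.exp (-θmin)

/-- Unfolding `gTail`. [cite: ArmstrongVicol2025, §3] -/
theorem gTail_def (j j' : Fin 26) :
    gTail j j' = G0 * ((cubatureWord.phase j).τ / ‖Torus.latticeVec (cubatureWord.phase j).m‖) * Bst j' * Real.exp (-θmin) := rfl

end Summit.AnomalousDissipation.AnomalousDissipation.Theorems.SolenoidalFractalHomogenisation.LagrangianStep.D1Tail

end
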